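import Mathlib
import Summits.Ventures.PercRepro2.ThreeTermUpsetPairs

/-!
# Three-terminal parts, V b: the joined law and its typed Harris sum
(blind cell PercRepro2, night-3 g31, 2026-08-30; `proofs/NIGHT3-CERT.md` §40)

First half of the join closure of the typed-Harris cone (ThreeTermJoinClosure.lean proves the
theorem).  For an abstract law `n` on patterns and a typed part `(S, τ, pat)`:

* `joinLaw n S τ pat i j k = Σ_{a b c} Σ_{x y z typed} [a ⊔ pat x = i] [b ⊔ pat y = j] [c ⊔ pat z = k] · n a b c`
  — the JOINED law (the pattern of copy `i` is the join of the abstract pattern and the part's, the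
  part's typed triple independent of `n`); it is nonnegative and copy-symmetric when `n` is
  (`joinLaw_nonneg`, `joinLaw_sym`);
* its typed Harris sum at `(a′, s)` collapses to a sum over `(a, b, c)` and typed triples `(x, y, z)`
  of `n a b c · hq s (π (b ⊔ pat y)) (π (c ⊔ pat z))` restricted to `a ⊔ pat x = a′` (`joinHarris_eq`),
  and by the copy symmetry the symmetrised coefficient `hq` may be replaced by the unsymmetrised slack
  `hh` (`joinHarris_hh`);
* two bounds on the antipodal cube of ThreeTermAntipode.lean, for upper sets `P`, `Q`: the MIXED
  antipodal bound `#{cube : P ∧ Q ∘ ant} ≤ κ · #{P} · #{Q}` (`antipodal_mixed`, `κ = (½)^{|Sp|}`: mixed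
  Harris + the antipode preserving the count) and Harris on the cube `κ · #{P} · #{Q} ≤ #{P ∧ Q}`
  (`cube_harris`) — the two halves of g30's `antipodal_harris`, kept apart because the join closure
  needs the product in between.

Own work; standard axioms.
-/

namespace Summit.Ventures.PercRepro2

open Block ThreeTerm TypedStar

namespace Part

/-! ## The mixed antipodal bound and Harris on the cube -/

section CubeBounds

variable {E : Type*} [Fintype E] [DecidableEq E] (S : Finset E) (τ : E → ℕ) (x : Config E)

/-- **The mixed antipodal bound**: for upper sets `P`, `Q`, the count of cube points with `y ∈ P` and
`ant y ∈ Q` is at most `κ · #{P} · #{Q}`, `κ = (½)^{|Sp|}` (mixed Harris, the antipode preserving the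
count). -/
theorem antipodal_mixed (P Q : Config E → Prop) [DecidablePred P] [DecidablePred Q]
    (hP : IsUpperSet {y | P y}) (hQ : IsUpperSet {y | Q y}) :
    (∑ y : Config E, if InCube S τ x y ∧ P y ∧ Q (ant S τ x y) then (1 : ℚ) else 0) ≤
      (1 / 2 : ℚ) ^ (splitSet S τ x).card *
        ((∑ y : Config E, if InCube S τ x y ∧ P y then (1 : ℚ) else 0) *
          ∑ y : Config E, if InCube S τ x y ∧ Q y then (1 : ℚ) else 0) := by
  have hp := isProbVec_px S τ x
  set c : ℚ := (1 / 2 : ℚ) ^ (splitSet S τ x).card with hc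
  have hcpos : 0 < c := by positivity
  have h1 := prob_inter_le_prob_mul_prob_of_isLowerSet hp (isLowerSet_ant S τ x Q hQ) hP
  have e1 : ({y | Q (ant S τ x y)} ∩ {y | P y} : Set (Config E)) = {y | P y ∧ Q (ant S τ x y)} := by
    ext y; simp [and_comm]
  rw [e1] at h1
  rw [prob_px, prob_px, prob_px] at h1
  rw [sum_ant] at h1
  have key : c * (∑ y : Config E, if InCube S τ x y ∧ (P y ∧ Q (ant S τ x y)) then (1 : ℚ) else 0) ≤
      c * (c * ((∑ y : Config E, if InCube S τ x y ∧ P y then (1 : ℚ) else 0) *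
        ∑ y : Config E, if InCube S τ x y ∧ Q y then (1 : ℚ) else 0)) := by
    calc c * (∑ y : Config E, if InCube S τ x y ∧ (P y ∧ Q (ant S τ x y)) then (1 : ℚ) else 0)
        ≤ (c * ∑ y : Config E, if InCube S τ x y ∧ Q y then (1 : ℚ) else 0) *
          (c * ∑ y : Config E, if InCube S τ x y ∧ P y then (1 : ℚ) else 0) := h1
      _ = c * (c * ((∑ y : Config E, if InCube S τ x y ∧ P y then (1 : ℚ) else 0) *
          ∑ y : Config E, if InCube S τ x y ∧ Q y then (1 : ℚ) else 0)) := by ring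
  exact le_of_mul_le_mul_left key hcpos

/-- **Harris on the cube**: for upper sets `P`, `Q`, `κ · #{P} · #{Q} ≤ #{P ∧ Q}`. -/
theorem cube_harris (P Q : Config E → Prop) [DecidablePred P] [DecidablePred Q]
    (hP : IsUpperSet {y | P y}) (hQ : IsUpperSet {y | Q y}) :
    (1 / 2 : ℚ) ^ (splitSet S τ x).card *
        ((∑ y : Config E, if InCube S τ x y ∧ P y then (1 : ℚ) else 0) *
          ∑ y : Config E, if InCube S τ x y ∧ Q y then (1 : ℚ) else 0) ≤
      ∑ y : Config E, if InCube S τ x y ∧ P y ∧ Q y then (1 : ℚ) else 0 := by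
  have hp := isProbVec_px S τ x
  set c : ℚ := (1 / 2 : ℚ) ^ (splitSet S τ x).card with hc
  have hcpos : 0 < c := by positivity
  have h2 := prob_mul_prob_le_prob_inter hp hP hQ
  have e2 : ({y | P y} ∩ {y | Q y} : Set (Config E)) = {y | P y ∧ Q y} := by
    ext y; simp
  rw [e2] at h2
  rw [prob_px, prob_px, prob_px] at h2
  have key : c * (c * ((∑ y : Config E, if InCube S τ x y ∧ P y then (1 : ℚ) else 0) *
        ∑ y : Config E, if InCube S τ x y ∧ Q y then (1 : ℚ) else 0)) ≤
      c * ∑ y : Config E, if InCube S τ x y ∧ (P y ∧ Q y) then (1 : ℚ) else 0 := by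
    calc c * (c * ((∑ y : Config E, if InCube S τ x y ∧ P y then (1 : ℚ) else 0) *
          ∑ y : Config E, if InCube S τ x y ∧ Q y then (1 : ℚ) else 0))
        = (c * ∑ y : Config E, if InCube S τ x y ∧ P y then (1 : ℚ) else 0) *
          (c * ∑ y : Config E, if InCube S τ x y ∧ Q y then (1 : ℚ) else 0) := by ring
      _ ≤ c * ∑ y : Config E, if InCube S τ x y ∧ (P y ∧ Q y) then (1 : ℚ) else 0 := h2
  exact le_of_mul_le_mul_left key hcpos

end CubeBounds

/-! ## The joined law -/

section JoinLaw

variable {E : Type*} [Fintype E] [DecidableEq E]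

/-- **The joined law**: an abstract law `n` on patterns, joined copywise with the typed configurations
of a part `(S, τ, pat)`. -/
noncomputable def joinLaw (n : Fin 8 → Fin 8 → Fin 8 → ℚ) (S : Finset E) (τ : E → ℕ)
    (pat : Config E → Fin 8) (i j k : Fin 8) : ℚ :=
  ∑ a : Fin 8, ∑ b : Fin 8, ∑ c : Fin 8, ∑ x : Config E, ∑ y : Config E, ∑ z : Config E,
    if ((SuppOn S x ∧ SuppOn S y ∧ SuppOn S z) ∧ (∀ e ∈ S, openCount x y z e = τ e)) ∧
        (orP a (pat x) = i ∧ orP b (pat y) = j ∧ orP c (pat z) = k) then n a b c else 0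

/-- The joined law of a nonnegative law is nonnegative. -/
lemma joinLaw_nonneg {n : Fin 8 → Fin 8 → Fin 8 → ℚ} (hn0 : ∀ i j k, 0 ≤ n i j k) (S : Finset E)
    (τ : E → ℕ) (pat : Config E → Fin 8) (i j k : Fin 8) : 0 ≤ joinLaw n S τ pat i j k := by
  unfold joinLaw
  refine Finset.sum_nonneg fun a _ => Finset.sum_nonneg fun b _ => Finset.sum_nonneg fun c _ =>
    Finset.sum_nonneg fun x _ => Finset.sum_nonneg fun y _ => Finset.sum_nonneg fun z _ => ?_
  split_ifs
  · exact hn0 a b c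
  · exact le_refl 0

omit [Fintype E] [DecidableEq E] in
/-- The typed-triple condition is symmetric in copies 1 and 2. -/
lemma typed_swap12 (S : Finset E) (τ : E → ℕ) (x y z : Config E) :
    ((SuppOn S x ∧ SuppOn S y ∧ SuppOn S z) ∧ ∀ e ∈ S, openCount x y z e = τ e) ↔
      ((SuppOn S y ∧ SuppOn S x ∧ SuppOn S z) ∧ ∀ e ∈ S, openCount y x z e = τ e) := by
  simp only [openCount_swap12 x y z]
  constructor <;> rintro ⟨⟨h1, h2, h3⟩, h4⟩ <;> exact ⟨⟨h2, h1, h3⟩, h4⟩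

/-- The joined law of a copy-symmetric law is copy-symmetric. -/
lemma joinLaw_sym {n : Fin 8 → Fin 8 → Fin 8 → ℚ} (hn : Sym3 n) (S : Finset E) (τ : E → ℕ)
    (pat : Config E → Fin 8) : Sym3 (joinLaw n S τ pat) where
  swap12 := by
    intro i j k
    unfold joinLaw
    rw [Finset.sum_comm]
    refine Finset.sum_congr rfl fun b _ => Finset.sum_congr rfl fun a _ => Finset.sum_congr rfl fun c _ => ?_
    rw [Finset.sum_comm]
    refine Finset.sum_congr rfl fun y _ => Finset.sum_congr rfl fun x _ => Finset.sum_congr rfl fun z _ => ?_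
    rw [if_congr (and_congr (typed_swap12 S τ x y z) and_left_comm) (hn.swap12 a b c) rfl]
  swap23 := by
    intro i j k
    unfold joinLaw
    refine Finset.sum_congr rfl fun a _ => ?_
    rw [Finset.sum_comm]
    refine Finset.sum_congr rfl fun c _ => Finset.sum_congr rfl fun b _ => Finset.sum_congr rfl fun x _ => ?_
    rw [Finset.sum_comm]
    refine Finset.sum_congr rfl fun z _ => Finset.sum_congr rfl fun y _ => ?_
    rw [if_congr (and_congr (typed_swap23 S τ x y z) (and_congr Iff.rfl and_comm)) (hn.swap23 a b c) rfl]

end JoinLaw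

/-! ## The typed Harris sum of the joined law -/

section JoinHarris

variable {E : Type*} [Fintype E] [DecidableEq E]

/-- Commuting two outer sums past six inner sums. -/
lemma sum26_comm {A B X₁ X₂ X₃ X₄ X₅ X₆ : Type*} [Fintype A] [Fintype B] [Fintype X₁] [Fintype X₂]
    [Fintype X₃] [Fintype X₄] [Fintype X₅] [Fintype X₆]
    (f : A → B → X₁ → X₂ → X₃ → X₄ → X₅ → X₆ → ℚ) :
    (∑ a, ∑ b, ∑ x₁, ∑ x₂, ∑ x₃, ∑ x₄, ∑ x₅, ∑ x₆, f a b x₁ x₂ x₃ x₄ x₅ x₆) =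
      ∑ x₁, ∑ x₂, ∑ x₃, ∑ x₄, ∑ x₅, ∑ x₆, ∑ a, ∑ b, f a b x₁ x₂ x₃ x₄ x₅ x₆ :=
  calc (∑ a, ∑ b, ∑ x₁, ∑ x₂, ∑ x₃, ∑ x₄, ∑ x₅, ∑ x₆, f a b x₁ x₂ x₃ x₄ x₅ x₆)
      = ∑ u : A × B, ∑ v : X₁ × X₂ × X₃ × X₄ × X₅ × X₆,
          f u.1 u.2 v.1 v.2.1 v.2.2.1 v.2.2.2.1 v.2.2.2.2.1 v.2.2.2.2.2 := by
        simp only [Fintype.sum_prod_type]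
    _ = ∑ v : X₁ × X₂ × X₃ × X₄ × X₅ × X₆, ∑ u : A × B,
          f u.1 u.2 v.1 v.2.1 v.2.2.1 v.2.2.2.1 v.2.2.2.2.1 v.2.2.2.2.2 := Finset.sum_comm
    _ = ∑ x₁, ∑ x₂, ∑ x₃, ∑ x₄, ∑ x₅, ∑ x₆, ∑ a, ∑ b, f a b x₁ x₂ x₃ x₄ x₅ x₆ := by
        simp only [Fintype.sum_prod_type]

/-- Bringing the copy-1 sum out past two pattern sums. -/
lemma sum_x_out {B C X Y Z : Type*} [Fintype B] [Fintype C] [Fintype X] [Fintype Y] [Fintype Z]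
    (f : B → C → X → Y → Z → ℚ) :
    (∑ b, ∑ c, ∑ x, ∑ y, ∑ z, f b c x y z) = ∑ x, ∑ b, ∑ c, ∑ y, ∑ z, f b c x y z :=
  calc (∑ b, ∑ c, ∑ x, ∑ y, ∑ z, f b c x y z)
      = ∑ u : B × C, ∑ x, ∑ y, ∑ z, f u.1 u.2 x y z := by simp only [Fintype.sum_prod_type]
    _ = ∑ x, ∑ u : B × C, ∑ y, ∑ z, f u.1 u.2 x y z := Finset.sum_comm
    _ = ∑ x, ∑ b, ∑ c, ∑ y, ∑ z, f b c x y z := by simp only [Fintype.sum_prod_type]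

/-- **The typed Harris sum of the joined law** collapses to a sum over `(a, b, c)` and typed triples. -/
lemma joinHarris_eq (n : Fin 8 → Fin 8 → Fin 8 → ℚ) (S : Finset E) (τ : E → ℕ)
    (pat : Config E → Fin 8) (a' : Fin 8) (s : Fin 9) :
    (∑ b' : Fin 8, ∑ c' : Fin 8, hq s (πpat b') (πpat c') * joinLaw n S τ pat a' b' c') =
      ∑ a : Fin 8, ∑ b : Fin 8, ∑ c : Fin 8, ∑ x : Config E, ∑ y : Config E, ∑ z : Config E,
        if ((SuppOn S x ∧ SuppOn S y ∧ SuppOn S z) ∧ (∀ e ∈ S, openCount x y z e = τ e)) ∧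
            orP a (pat x) = a'
          then n a b c * hq s (πpat (orP b (pat y))) (πpat (orP c (pat z))) else 0 := by
  simp only [joinLaw, Finset.mul_sum]
  rw [sum26_comm]
  refine Finset.sum_congr rfl fun a _ => Finset.sum_congr rfl fun b _ => Finset.sum_congr rfl fun c _ =>
    Finset.sum_congr rfl fun x _ => Finset.sum_congr rfl fun y _ => Finset.sum_congr rfl fun z _ => ?_
  by_cases h : ((SuppOn S x ∧ SuppOn S y ∧ SuppOn S z) ∧ (∀ e ∈ S, openCount x y z e = τ e)) ∧
      orP a (pat x) = a'
  · rw [if_pos h, ← sum_collapse2 (fun b' c' => n a b c * hq s (πpat b') (πpat c')) (orP b (pat y))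
      (orP c (pat z))]
    refine Finset.sum_congr rfl fun b' _ => Finset.sum_congr rfl fun c' _ => ?_
    by_cases hbc : orP b (pat y) = b' ∧ orP c (pat z) = c'
    · rw [if_pos hbc, if_pos ⟨h.1, h.2, hbc.1, hbc.2⟩, mul_comm]
    · rw [if_neg hbc, if_neg (fun h' => hbc ⟨h'.2.2.1, h'.2.2.2⟩), mul_zero]
  · rw [if_neg h]
    refine Finset.sum_eq_zero fun b' _ => Finset.sum_eq_zero fun c' _ => ?_
    rw [if_neg (fun h' => h ⟨h'.1, h'.2.1⟩), mul_zero]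

/-- Swapping `(b, y)` with `(c, z)` in the collapsed sum. -/
lemma joinHarris_swap (n : Fin 8 → Fin 8 → Fin 8 → ℚ) (hn : Sym3 n) (S : Finset E) (τ : E → ℕ)
    (pat : Config E → Fin 8) (a' : Fin 8) (g : Fin 5 → Fin 5 → ℚ) :
    (∑ a : Fin 8, ∑ b : Fin 8, ∑ c : Fin 8, ∑ x : Config E, ∑ y : Config E, ∑ z : Config E,
        if ((SuppOn S x ∧ SuppOn S y ∧ SuppOn S z) ∧ (∀ e ∈ S, openCount x y z e = τ e)) ∧
            orP a (pat x) = a'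
          then n a b c * g (πpat (orP c (pat z))) (πpat (orP b (pat y))) else 0) =
      ∑ a : Fin 8, ∑ b : Fin 8, ∑ c : Fin 8, ∑ x : Config E, ∑ y : Config E, ∑ z : Config E,
        if ((SuppOn S x ∧ SuppOn S y ∧ SuppOn S z) ∧ (∀ e ∈ S, openCount x y z e = τ e)) ∧
            orP a (pat x) = a'
          then n a b c * g (πpat (orP b (pat y))) (πpat (orP c (pat z))) else 0 := by
  refine Finset.sum_congr rfl fun a _ => ?_
  rw [Finset.sum_comm]
  refine Finset.sum_congr rfl fun c _ => Finset.sum_congr rfl fun b _ => Finset.sum_congr rfl fun x _ => ?_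
  rw [Finset.sum_comm]
  refine Finset.sum_congr rfl fun z _ => Finset.sum_congr rfl fun y _ => ?_
  by_cases h : ((SuppOn S x ∧ SuppOn S y ∧ SuppOn S z) ∧ (∀ e ∈ S, openCount x y z e = τ e)) ∧
      orP a (pat x) = a'
  · rw [if_pos h, if_pos ⟨(typed_swap23 S τ x y z).1 h.1, h.2⟩, hn.swap23 a b c]
  · rw [if_neg h, if_neg (fun h' => h ⟨(typed_swap23 S τ x y z).2 h'.1, h'.2⟩)]

/-- **The typed Harris sum of the joined law with the unsymmetrised slack.** -/
lemma joinHarris_hh (n : Fin 8 → Fin 8 → Fin 8 → ℚ) (hn : Sym3 n) (S : Finset E) (τ : E → ℕ)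
    (pat : Config E → Fin 8) (a' : Fin 8) (s : Fin 9) :
    (∑ b' : Fin 8, ∑ c' : Fin 8, hq s (πpat b') (πpat c') * joinLaw n S τ pat a' b' c') =
      ∑ a : Fin 8, ∑ b : Fin 8, ∑ c : Fin 8, ∑ x : Config E, ∑ y : Config E, ∑ z : Config E,
        if ((SuppOn S x ∧ SuppOn S y ∧ SuppOn S z) ∧ (∀ e ∈ S, openCount x y z e = τ e)) ∧
            orP a (pat x) = a'
          then n a b c * hh s (πpat (orP b (pat y))) (πpat (orP c (pat z))) else 0 := by
  rw [joinHarris_eq]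
  have h2 : ∀ (a b c : Fin 8) (x y z : Config E),
      (if ((SuppOn S x ∧ SuppOn S y ∧ SuppOn S z) ∧ (∀ e ∈ S, openCount x y z e = τ e)) ∧
          orP a (pat x) = a'
        then n a b c * hq s (πpat (orP b (pat y))) (πpat (orP c (pat z))) else 0) =
      ((if ((SuppOn S x ∧ SuppOn S y ∧ SuppOn S z) ∧ (∀ e ∈ S, openCount x y z e = τ e)) ∧
          orP a (pat x) = a'
        then n a b c * hh s (πpat (orP b (pat y))) (πpat (orP c (pat z))) else 0) +
       (if ((SuppOn S x ∧ SuppOn S y ∧ SuppOn S z) ∧ (∀ e ∈ S, openCount x y z e = τ e)) ∧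
          orP a (pat x) = a'
        then n a b c * hh s (πpat (orP c (pat z))) (πpat (orP b (pat y))) else 0)) / 2 := by
    intro a b c x y z
    split_ifs
    · rw [hq_eq_hh]; ring
    · norm_num
  simp only [h2, Finset.sum_add_distrib, ← Finset.sum_div]
  rw [joinHarris_swap n hn S τ pat a' (hh s)]
  ring

end JoinHarris

end Part

end Summit.Ventures.PercRepro2
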